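import Summits.QuantumFields.YangMills.Theorems.UnitScaleTiltSmoothLiftFibre
import Literature.MathematicalPhysics.QuantumFieldTheory.Balaban1983to89.BlockAveragingEMLHaarAC
import HarnessLib

/-!
# Route `UnitScaleTilt`, crux K1 child «MinimiserStabilityRegPr» (stmt-QuantumFields-19200), stub `stub_smoothLift` (G-K1a-2′) — helper P1b:
# THE EXACT-LIFT CORRECTION THEOREM — a fine field whose (0.4)-average is `ρ`-consistent with a coarse target `V` is corrected
# to an EXACT lift of `V` by moving only the central crossing bonds, each by `O(ρ)`

Fleet seat `ym-ust-19200-p2` (gen 0).  The located gap G-K1a-2′ (`T3UpperLiftSplit.SmoothLiftAt`) asks for EXACT one-step lifts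
through Bałaban's block averaging (0.4) with the printed exp-mean-log operation on `SU(2)` (`BlockAveraging.avgFun expMeanLogSU`).
The intended mechanism of the line card — "smooth interpolation + correction by the right inverse of the linearised averaging" —
is realised here WITHOUT any implicit-function theorem, through the PRIVATE COORDINATES of (0.4) (`BlockAveragingHaarAC`, FACT (A):
the central crossing bond `β(c)` of the coarse bond `c` is seen by `Ū(c)` only) and the ONE-VARIABLE NORMAL FORM of
`BlockAveragingEMLHaarAC` (`Ū′(c) = exp(Σ_k |I|⁻¹ log(h_k W*))·W`, `W = pre·g·post`, `h_k` the off-central open holonomies,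
independent of every central crossing bond), plus the fibre equation solved in `UnitScaleTiltSmoothLiftFibre` (3-dim Brouwer).

* §1 central re-assignments (`U′(β(c)) = g(c)`, `U′ = U` elsewhere) and **`avgFun_of_central_update`**: `Ū′(c) = fibreMap_U(pre_U·g(c)·post_U)` — the
  simultaneous re-assignments at the other coarse bonds are invisible at `c` (FACT (A) for the open holonomies, the straight line,
  `pre`, `post`).
* §2 **`exists_exact_lift_of_consistent`**: for a fine `SU(2)` field `U` and a coarse target `V` (standing range `j + 1 ≤ m + K`) with
  `‖h_k V(c)* − 1‖ ≤ 1/(40|I|)` and `‖Σ_k |I|⁻¹ log(h_k V(c)*)‖ ≤ ρ ≤ 1/(40|I|)` at every `c`, the field equal to `U` off the central crossing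
  bonds and to `pre⁻¹·e^{−X_c}V(c)·post⁻¹` at `β(c)` (`X_c ∈ 𝔰𝔲(2)`, `‖X_c‖ ≤ 2|I|ρ`) satisfies `avgFun expMeanLogSU U′ = V` EXACTLY
  (`θ = 1 − m|I|⁻¹ ≥ |I|⁻¹`: there is a central index); **`exists_exact_lift_of_loops`**: the same from `axialAvg U = V`, loop variables
  `≤ 1/(40|I|)` and mean logarithms `≤ ρ` — each central crossing bond moves by `≤ 4|I|ρ`, nothing else is touched.
Elementary; nothing of Bałaban's is asserted.  Consumer: the interpolation of the smooth regime of G-K1a-2′ (same seat, next files).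
-/

noncomputable section

open NormedSpace Function
open scoped Matrix.Norms.L2Operator

namespace Summit.QuantumFields.YangMills.Theorems.SmoothLiftCorrection

open Literature.MathematicalPhysics.QuantumFieldTheory.Balaban1983to89
open MatrixLog ExpMeanLog T4Continuum AveragingRT BlockAveraging BlockAveragingHaarAC BlockAveragingEMLHaarAC
open Summit.QuantumFields.YangMills.Theorems.SmoothLiftFibre

/-! ## §1 The correction on the private coordinates -/

section Correction

variable {P : Params} {j : ℕ} {G : Type*} [DecidableEq (PBond P j)]

/-- A CENTRAL RE-ASSIGNMENT `U′` of `U` with values `g`: `U′(β(c)) = g(c)` at every central crossing bond and `U′ = U` elsewhere.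
With `β(c)` reset to `U(β(c))`, such a field agrees with `U` on every bond that is not a central crossing bond of some `c′ ≠ c`.
[folklore] -/
private theorem reset_apply {U U' : GaugeField P j G} (hU' : ∀ b : PBond P j, (∀ c, centralBond c ≠ b) → U' b = U b)
    (c : PBond P (j+1)) {b : PBond P j} (hb : ∀ c', centralBond c' = b → c' = c) :
    update U' (centralBond c) (U (centralBond c)) b = U b := by
  by_cases h : b = centralBond c
  · subst h; rw [update_self]
  · rw [update_of_ne h]
    exact hU' b fun c' hc' => h (by rw [← hc', hb c' hc'])

/-- A central re-assignment is its own reset updated at `β(c)`. [folklore] -/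
private theorem eq_update_reset {U U' : GaugeField P j G} {g : PBond P (j+1) → G} (hg : ∀ c, U' (centralBond c) = g c)
    (c : PBond P (j+1)) : U' = update (update U' (centralBond c) (U (centralBond c))) (centralBond c) (g c) := by
  funext b
  by_cases h : b = centralBond c
  · subst h; rw [update_self, hg]
  · rw [update_of_ne h, update_of_ne h]

variable [GaugeGroup G]

/-- The open holonomies at `c` of the reset field are those of `U` (FACT (A): the only central crossing bond on
`Γ ∪ [x,x′] ∪ (−Γ′)` at `c` is `β(c)`). [folklore] -/
private theorem openHol_reset (hj : j + 1 ≤ P.m + P.K) {U U' : GaugeField P j G}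
    (hU' : ∀ b : PBond P j, (∀ c, centralBond c ≠ b) → U' b = U b) (c : PBond P (j+1)) (i : Idx P) :
    openHol (update U' (centralBond c) (U (centralBond c))) c i = openHol U c i := by
  unfold openHol
  exact T4ReflectionCone.holAt_congr fun s hs =>
    reset_apply hU' c fun c' hc' => (central_of_mem_walk_openWord hj c c' i.1 i.2.1 i.2.2 hs hc'.symm).1

/-- The straight-line transports at `c` of the reset field are those of `U`. [folklore] -/
private theorem holAt_line_reset (hj : j + 1 ≤ P.m + P.K) {U U' : GaugeField P j G}
    (hU' : ∀ b : PBond P j, (∀ c, centralBond c ≠ b) → U' b = U b) (c : PBond P (j+1)) {γ : List (LStep P j)}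
    (hγ : ∀ s ∈ γ, s ∈ walk (emb c.src) (List.replicate P.L (c.dir, true))) :
    holAt (update U' (centralBond c) (U (centralBond c))) γ = holAt U γ :=
  T4ReflectionCone.holAt_congr fun s hs =>
    reset_apply hU' c fun c' hc' => eq_of_mem_walk_line_of_eq_centralBond hj c c' (hγ s hs) hc'.symm

/-- `pre` of the reset field is `pre U`. [folklore] -/
private theorem pre_reset (hj : j + 1 ≤ P.m + P.K) {U U' : GaugeField P j G}
    (hU' : ∀ b : PBond P j, (∀ c, centralBond c ≠ b) → U' b = U b) (c : PBond P (j+1)) :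
    pre (update U' (centralBond c) (U (centralBond c))) c = pre U c := by
  unfold pre
  refine holAt_line_reset hj hU' c fun s hs => ?_
  have hsplit : List.replicate P.L ((c.dir, true) : Letter P.d) =
      List.replicate ((P.L - 1) / 2) (c.dir, true) ++ List.replicate (P.L - (P.L - 1) / 2) (c.dir, true) := by
    rw [List.replicate_append_replicate]; congr 1; have := two_mul_half_add_one P; omega
  rw [hsplit, walk_append]
  exact List.mem_append_left _ hs

/-- `post` of the reset field is `post U`. [folklore] -/
private theorem post_reset (hj : j + 1 ≤ P.m + P.K) {U U' : GaugeField P j G}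
    (hU' : ∀ b : PBond P j, (∀ c, centralBond c ≠ b) → U' b = U b) (c : PBond P (j+1)) :
    post (update U' (centralBond c) (U (centralBond c))) c = post U c := by
  unfold post
  refine holAt_line_reset hj hU' c fun s hs => ?_
  have hsplit : List.replicate P.L ((c.dir, true) : Letter P.d) =
      List.replicate ((P.L - 1) / 2 + 1) (c.dir, true) ++ List.replicate ((P.L - 1) / 2) (c.dir, true) := by
    rw [List.replicate_append_replicate]; congr 1; have := two_mul_half_add_one P; omega
  rw [hsplit, walk_append, walkEnd_replicate_line]
  exact List.mem_append_right _ hs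

/-- **THE NORMAL FORM FOR SIMULTANEOUS CENTRAL RE-ASSIGNMENTS**: if `U′(β(c)) = g(c)` at every central crossing bond and `U′ = U`
elsewhere, then `Ū′(c) = fibreMap_U(pre_U · g(c) · post_U)` — the re-assignments at the other coarse bonds are invisible at `c`. [folklore] -/
theorem avgFun_of_central_update (hj : j + 1 ≤ P.m + P.K) (ℰ : LoopAverage G) {U U' : GaugeField P j G} {g : PBond P (j+1) → G}
    (hg : ∀ c, U' (centralBond c) = g c) (hU' : ∀ b : PBond P j, (∀ c, centralBond c ≠ b) → U' b = U b)
    (c : PBond P (j+1)) : avgFun ℰ U' c = fibreMap ℰ U c (pre U c * g c * post U c) := by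
  set U₁ := update U' (centralBond c) (U (centralBond c)) with hU₁
  have hfam : fibreFamily U₁ c = fibreFamily U c := by
    funext W i
    by_cases h : IsCentral c i
    · rw [fibreFamily_of_isCentral _ c W i h, fibreFamily_of_isCentral _ c W i h]
    · rw [fibreFamily_of_not_isCentral _ c W i h, fibreFamily_of_not_isCentral _ c W i h, openHol_reset hj hU']
  have hmap : fibreMap ℰ U₁ c = fibreMap ℰ U c := by
    funext W
    unfold fibreMap FibreSmall
    rw [hfam]
  rw [eq_update_reset (U := U) hg c, avgFun_update_centralBond_self hj ℰ, ← hU₁, pre_reset hj hU', post_reset hj hU', hmap]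

end Correction

/-! ## §2 The exact lift on `SU(2)` with the printed exp-mean-log average -/

section SU2

variable {P : Params} {j : ℕ} [DecidableEq (PBond P j)]

/-- `(e^{−X})* = e^{X}` for `X ∈ 𝔰𝔲(2)`. [folklore] -/
private theorem star_exp_neg_of_mem_su {X : Matrix (Fin 2) (Fin 2) ℂ} (hX : X ∈ (specialUnitaryLogChart (Fin 2)).lie) : star (exp (-X)) = exp X := by
  letI : NormedAlgebra ℚ (Matrix (Fin 2) (Fin 2) ℂ) := NormedAlgebra.restrictScalars ℚ ℂ _
  rw [star_exp, star_neg, (mem_specialUnitaryLogChart_lie.1 hX).1, neg_neg]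

/-- **THE EXACT-LIFT CORRECTION THEOREM.**  Let `U` be a fine `SU(2)` field on `T^{(j)}` and `V` a coarse field on `T^{(j+1)}`
(standing range `j + 1 ≤ m + K`), and suppose that at every coarse bond `c` the off-central open holonomies `h_k` of (0.4) satisfy
`‖h_k V(c)* − 1‖ ≤ 1/(40|I|)` (`I` = the index set of (0.4)) and the CONSISTENCY `‖Σ_k |I|⁻¹ log(h_k V(c)*)‖ ≤ ρ ≤ 1/(40|I|)`.  Then there
are `X_c ∈ 𝔰𝔲(2)` with `‖X_c‖ ≤ 2|I|ρ` such that the field `U′` equal to `U` off the central crossing bonds and to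
`pre_U(c)⁻¹ · e^{−X_c} V(c) · post_U(c)⁻¹` at `β(c)` is an EXACT lift of `V` through Bałaban's averaging (0.4) with the printed
exp-mean-log operation: `avgFun expMeanLogSU U′ = V`. [cite: Balaban1987RG1, (0.4) p.253] -/
theorem exists_exact_lift_of_consistent (hj : j + 1 ≤ P.m + P.K)
    (U : GaugeField P j (Matrix.specialUnitaryGroup (Fin 2) ℂ)) (V : GaugeField P (j+1) (Matrix.specialUnitaryGroup (Fin 2) ℂ))
    {ρ : ℝ}
    (hη : ∀ (c : PBond P (j+1)) (k : Fin (offCard c)),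
      ‖((offHol U c k : Matrix.specialUnitaryGroup (Fin 2) ℂ) : Matrix (Fin 2) (Fin 2) ℂ) *
          star ((V c : Matrix.specialUnitaryGroup (Fin 2) ℂ) : Matrix (Fin 2) (Fin 2) ℂ) - 1‖ ≤ 1 / (40 * Fintype.card (Idx P)))
    (hρ : ∀ c : PBond P (j+1),
      ‖∑ k : Fin (offCard c), ((emlWeight P : ℝ) : ℂ) •
          mlog (((offHol U c k : Matrix.specialUnitaryGroup (Fin 2) ℂ) : Matrix (Fin 2) (Fin 2) ℂ) *
            star ((V c : Matrix.specialUnitaryGroup (Fin 2) ℂ) : Matrix (Fin 2) (Fin 2) ℂ))‖ ≤ ρ)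
    (hρ' : ρ ≤ 1 / (40 * Fintype.card (Idx P))) :
    ∃ (X : PBond P (j+1) → Matrix (Fin 2) (Fin 2) ℂ) (hX : ∀ c, X c ∈ (specialUnitaryLogChart (Fin 2)).lie),
      (∀ c, ‖X c‖ ≤ 2 * Fintype.card (Idx P) * ρ) ∧
      ∀ U' : GaugeField P j (Matrix.specialUnitaryGroup (Fin 2) ℂ),
        (∀ c, U' (centralBond c) =
          (pre U c)⁻¹ * ((⟨exp (-X c), (specialUnitaryLogChart (Fin 2)).exp_mem (Submodule.neg_mem _ (hX c))⟩ :
            Matrix.specialUnitaryGroup (Fin 2) ℂ) * V c) * (post U c)⁻¹) →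
        (∀ b : PBond P j, (∀ c, centralBond c ≠ b) → U' b = U b) →
        avgFun expMeanLogSU U' = V := by
  letI : NormedAlgebra ℚ (Matrix (Fin 2) (Fin 2) ℂ) := NormedAlgebra.restrictScalars ℚ ℂ _
  -- the constants
  set N : ℕ := Fintype.card (Idx P) with hN
  have hN1 : (1 : ℝ) ≤ N := by exact_mod_cast (Fintype.card_pos (α := Idx P))
  have hNpos : (0 : ℝ) < N := by linarith
  have hw : 0 ≤ emlWeight P := emlWeight_nonneg P
  have hwN : emlWeight P = (N : ℝ)⁻¹ := rfl
  -- per bond: the fibre equation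
  have hfib : ∀ c : PBond P (j+1), ∃ X ∈ (specialUnitaryLogChart (Fin 2)).lie, ‖X‖ ≤ 2 * N * ρ ∧
      ∑ k : Fin (offCard c), ((emlWeight P : ℝ) : ℂ) •
        mlog (((offHol U c k : Matrix.specialUnitaryGroup (Fin 2) ℂ) : Matrix (Fin 2) (Fin 2) ℂ) *
          star ((V c : Matrix.specialUnitaryGroup (Fin 2) ℂ) : Matrix (Fin 2) (Fin 2) ℂ) * exp X) = X := by
    intro c
    have hθ : (0 : ℝ) < (N : ℝ)⁻¹ := inv_pos.mpr hNpos
    have hmw : (offCard c : ℝ) * emlWeight P ≤ 1 - (N : ℝ)⁻¹ := by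
      have hlt : (offCard c : ℝ) + 1 ≤ N := by exact_mod_cast offCard_lt_card c
      rw [hwN, ← sub_nonneg]
      have : 1 - (N : ℝ)⁻¹ - (offCard c : ℝ) * (N : ℝ)⁻¹ = ((N : ℝ) - (offCard c + 1)) * (N : ℝ)⁻¹ := by field_simp; ring
      rw [this]; exact mul_nonneg (by linarith) hθ.le
    have h40 : (1 : ℝ) / (40 * N) = (N : ℝ)⁻¹ / 40 := by field_simp
    obtain ⟨X, hXsu, hXn, hfix⟩ := exists_fixedPoint_meanLog
      (fun k => offHol U c k * (V c)⁻¹) (θ := (N : ℝ)⁻¹) (η := 1 / (40 * N)) (ρ := ρ) hw hθ hmw (by positivity)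
      (fun k => hη c k) (by rw [h40]; linarith [hθ.le]) (by rw [one_div_le_one_div (by positivity) (by norm_num)]; linarith)
      (hρ c) (by rw [← h40]; exact hρ')
    refine ⟨X, hXsu, ?_, hfix⟩
    calc ‖X‖ ≤ 2 * ρ / (N : ℝ)⁻¹ := hXn
      _ = 2 * N * ρ := by field_simp
  choose X hXsu hXn hfix using hfib
  refine ⟨X, hXsu, hXn, fun U' hg hU' => funext fun c => ?_⟩
  have hδ : deltaSU (Fin 2) = 1 / 3 := by
    unfold deltaSU; rw [Fintype.card_fin, min_eq_left]; have := Real.pi_gt_three; push_cast; linarith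
  -- the coarse bond variable after the update
  set E : Matrix.specialUnitaryGroup (Fin 2) ℂ :=
    ⟨exp (-X c), (specialUnitaryLogChart (Fin 2)).exp_mem (Submodule.neg_mem _ (hXsu c))⟩ with hE
  set W : Matrix.specialUnitaryGroup (Fin 2) ℂ := E * V c with hW
  have hcoeW : star ((W : Matrix.specialUnitaryGroup (Fin 2) ℂ) : Matrix (Fin 2) (Fin 2) ℂ) =
      star ((V c : Matrix.specialUnitaryGroup (Fin 2) ℂ) : Matrix (Fin 2) (Fin 2) ℂ) * exp (X c) := by
    rw [hW, Submonoid.coe_mul, star_mul, hE]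
    exact congrArg _ (star_exp_neg_of_mem_su (hXsu c))
  rw [avgFun_of_central_update hj expMeanLogSU hg hU']
  have hWeq : pre U c * ((pre U c)⁻¹ * (E * V c) * (post U c)⁻¹) * post U c = W := by rw [hW]; group
  rw [hWeq]
  -- the guard is on at `W`
  have hXsmall : ‖X c‖ ≤ 1 / 20 := by
    refine (hXn c).trans ?_
    calc 2 * (N : ℝ) * ρ ≤ 2 * N * (1 / (40 * N)) := by gcongr
      _ = 1 / 20 := by field_simp; ring
  have hguard : W ∈ fibreGuard expMeanLogSU U c := by
    intro i
    show dist1 (fibreFamily U c W i) < (expMeanLogSU (n := Fin 2)).δ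
    rw [expMeanLogSU_δ, ← deltaSU, hδ]
    by_cases hi : IsCentral c i
    · rw [fibreFamily_of_isCentral U c W i hi, GaugeGroup.dist1_one]; norm_num
    · rw [dist1_fibreFamily_of_not_isCentral U c W i hi, hcoeW, ← mul_assoc]
      set k : Fin (offCard c) := offEquiv c ⟨i, hi⟩ with hk_def
      have hk : openHol U c i = offHol U c k := by
        rw [hk_def, offHol, Equiv.symm_apply_apply]
      rw [hk]
      have h1 := norm_mul_exp_sub_one_le (offHol U c k * (V c)⁻¹) (X c)
      have h2 : Real.exp ‖X c‖ - 1 ≤ 2 * ‖X c‖ := exp_sub_one_le_two_mul (norm_nonneg _) (by linarith)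
      have h3 := hη c k
      have h4 : (1 : ℝ) / (40 * N) ≤ 1 / 40 := by
        rw [one_div_le_one_div (by positivity) (by norm_num)]; linarith
      have h5 : (((offHol U c k * (V c)⁻¹ : Matrix.specialUnitaryGroup (Fin 2) ℂ)) : Matrix (Fin 2) (Fin 2) ℂ) =
          ((offHol U c k : Matrix.specialUnitaryGroup (Fin 2) ℂ) : Matrix (Fin 2) (Fin 2) ℂ) *
            star ((V c : Matrix.specialUnitaryGroup (Fin 2) ℂ) : Matrix (Fin 2) (Fin 2) ℂ) := rfl
      rw [h5] at h1
      linarith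
  rw [fibreMap_of_mem _ U c hguard]
  apply Subtype.ext
  rw [coe_fibreCore_eq U c hguard, hcoeW]
  simp_rw [← mul_assoc]
  rw [hfix c, hW, Submonoid.coe_mul, hE, ← mul_assoc, ← exp_add_of_commute (Commute.refl (X c)).neg_right, add_neg_cancel,
    exp_zero, one_mul]


/-- Unitary bookkeeping: `‖p A q‖ ≤ ‖A‖` for `p, q ∈ SU(2)` (operator norms `≤ 1`). [folklore] -/
private theorem norm_conj_le (p q : Matrix.specialUnitaryGroup (Fin 2) ℂ) (A : Matrix (Fin 2) (Fin 2) ℂ) :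
    ‖((p : Matrix.specialUnitaryGroup (Fin 2) ℂ) : Matrix (Fin 2) (Fin 2) ℂ) * A *
        ((q : Matrix.specialUnitaryGroup (Fin 2) ℂ) : Matrix (Fin 2) (Fin 2) ℂ)‖ ≤ ‖A‖ := by
  calc _ ≤ ‖((p : Matrix.specialUnitaryGroup (Fin 2) ℂ) : Matrix (Fin 2) (Fin 2) ℂ) * A‖ *
        ‖((q : Matrix.specialUnitaryGroup (Fin 2) ℂ) : Matrix (Fin 2) (Fin 2) ℂ)‖ := norm_mul_le _ _
    _ ≤ ‖((p : Matrix.specialUnitaryGroup (Fin 2) ℂ) : Matrix (Fin 2) (Fin 2) ℂ) * A‖ * 1 := by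
        gcongr; exact norm_coe_su2_le q
    _ ≤ ‖((p : Matrix.specialUnitaryGroup (Fin 2) ℂ) : Matrix (Fin 2) (Fin 2) ℂ)‖ * ‖A‖ * 1 := by
        gcongr; exact norm_mul_le _ _
    _ ≤ 1 * ‖A‖ * 1 := by gcongr; exact norm_coe_su2_le p
    _ = ‖A‖ := by ring

/-- **THE EXACT-LIFT CORRECTION THEOREM, LOOP FORM** (the shape the interpolation of G-K1a-2′ feeds).  Let `U` be a fine `SU(2)`
field whose straight transporters ARE the target, `axialAvg U = V`, whose (0.4) loop variables are uniformly small,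
`|U(Γ ∪ [x,x′] ∪ (−Γ′) ∪ (−c)) − 1| ≤ 1/(40|I|)`, and whose mean logarithms are `ρ`-small at every coarse bond,
`‖Σ_i |I|⁻¹ log U(loop_i(c))‖ ≤ ρ ≤ 1/(40|I|)` — i.e. the correction factor of (0.4) is `e^{O(ρ)}` and `Ū(c) = e^{O(ρ)}V(c)`.  Then
moving each central crossing bond by at most `4|I|ρ` in operator norm (and touching nothing else) yields an EXACT lift `U′` of `V`:
`avgFun expMeanLogSU U′ = V`. [cite: Balaban1987RG1, (0.4) p.253] -/
theorem exists_exact_lift_of_loops (hj : j + 1 ≤ P.m + P.K)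
    (U : GaugeField P j (Matrix.specialUnitaryGroup (Fin 2) ℂ)) (V : GaugeField P (j+1) (Matrix.specialUnitaryGroup (Fin 2) ℂ))
    (haxial : ∀ c, axialAvg U c = V c) {ρ : ℝ}
    (hη : ∀ (c : PBond P (j+1)) (i : Idx P), dist1 (loopHol U c i) ≤ 1 / (40 * Fintype.card (Idx P)))
    (hρ : ∀ c : PBond P (j+1),
      ‖∑ i : Idx P, ((emlWeight P : ℝ) : ℂ) •
          mlog (((loopHol U c i : Matrix.specialUnitaryGroup (Fin 2) ℂ)) : Matrix (Fin 2) (Fin 2) ℂ)‖ ≤ ρ)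
    (hρ' : ρ ≤ 1 / (40 * Fintype.card (Idx P))) :
    ∃ U' : GaugeField P j (Matrix.specialUnitaryGroup (Fin 2) ℂ),
      (∀ b : PBond P j, (∀ c, centralBond c ≠ b) → U' b = U b) ∧
      (∀ c : PBond P (j+1),
        ‖((U' (centralBond c) : Matrix.specialUnitaryGroup (Fin 2) ℂ) : Matrix (Fin 2) (Fin 2) ℂ) -
            ((U (centralBond c) : Matrix.specialUnitaryGroup (Fin 2) ℂ) : Matrix (Fin 2) (Fin 2) ℂ)‖ ≤
          4 * Fintype.card (Idx P) * ρ) ∧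
      avgFun expMeanLogSU U' = V := by
  letI : NormedAlgebra ℚ (Matrix (Fin 2) (Fin 2) ℂ) := NormedAlgebra.restrictScalars ℚ ℂ _
  set N : ℕ := Fintype.card (Idx P) with hN
  have hN1 : (1 : ℝ) ≤ N := by exact_mod_cast (Fintype.card_pos (α := Idx P))
  -- the loop variables are  (off-central) and  (central)
  have hloop : ∀ c i, ((loopHol U c i : Matrix.specialUnitaryGroup (Fin 2) ℂ) : Matrix (Fin 2) (Fin 2) ℂ) =
      ((openHol U c i : Matrix.specialUnitaryGroup (Fin 2) ℂ) : Matrix (Fin 2) (Fin 2) ℂ) *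
        star ((V c : Matrix.specialUnitaryGroup (Fin 2) ℂ) : Matrix (Fin 2) (Fin 2) ℂ) := by
    intro c i; rw [loopHol_eq_openHol_mul, haxial]; rfl
  have hcentral : ∀ c i, IsCentral c i →
      mlog (((loopHol U c i : Matrix.specialUnitaryGroup (Fin 2) ℂ)) : Matrix (Fin 2) (Fin 2) ℂ) = 0 := by
    intro c i hi
    rw [loopHol_eq_openHol_mul, openHol_of_isCentral U c i hi, mul_inv_cancel]
    exact mlog_one
  -- the hypotheses of the enumerated form
  have hη' : ∀ (c : PBond P (j+1)) (k : Fin (offCard c)),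
      ‖((offHol U c k : Matrix.specialUnitaryGroup (Fin 2) ℂ) : Matrix (Fin 2) (Fin 2) ℂ) *
          star ((V c : Matrix.specialUnitaryGroup (Fin 2) ℂ) : Matrix (Fin 2) (Fin 2) ℂ) - 1‖ ≤ 1 / (40 * Fintype.card (Idx P)) := by
    intro c k
    have h := hη c ((offEquiv c).symm k).1
    have hd : dist1 (loopHol U c ((offEquiv c).symm k).1) =
        ‖((loopHol U c ((offEquiv c).symm k).1 : Matrix.specialUnitaryGroup (Fin 2) ℂ) : Matrix (Fin 2) (Fin 2) ℂ) - 1‖ := rfl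
    rwa [hd, hloop] at h
  have hρ'' : ∀ c : PBond P (j+1),
      ‖∑ k : Fin (offCard c), ((emlWeight P : ℝ) : ℂ) •
          mlog (((offHol U c k : Matrix.specialUnitaryGroup (Fin 2) ℂ) : Matrix (Fin 2) (Fin 2) ℂ) *
            star ((V c : Matrix.specialUnitaryGroup (Fin 2) ℂ) : Matrix (Fin 2) (Fin 2) ℂ))‖ ≤ ρ := by
    intro c
    have hsplit := Fintype.sum_subtype_add_sum_subtype (IsCentral c)
      (fun i => ((emlWeight P : ℝ) : ℂ) • mlog (((loopHol U c i : Matrix.specialUnitaryGroup (Fin 2) ℂ)) : Matrix (Fin 2) (Fin 2) ℂ))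
    have h0 : ∑ x : {i : Idx P // IsCentral c i},
        ((emlWeight P : ℝ) : ℂ) • mlog (((loopHol U c x : Matrix.specialUnitaryGroup (Fin 2) ℂ)) : Matrix (Fin 2) (Fin 2) ℂ) = 0 :=
      Fintype.sum_eq_zero _ fun x => by rw [hcentral c x x.2, smul_zero]
    rw [h0, zero_add] at hsplit
    have hre : ∑ x : {i : Idx P // ¬ IsCentral c i},
        ((emlWeight P : ℝ) : ℂ) • mlog (((loopHol U c x : Matrix.specialUnitaryGroup (Fin 2) ℂ)) : Matrix (Fin 2) (Fin 2) ℂ) =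
        ∑ k : Fin (offCard c), ((emlWeight P : ℝ) : ℂ) •
          mlog (((offHol U c k : Matrix.specialUnitaryGroup (Fin 2) ℂ) : Matrix (Fin 2) (Fin 2) ℂ) *
            star ((V c : Matrix.specialUnitaryGroup (Fin 2) ℂ) : Matrix (Fin 2) (Fin 2) ℂ)) :=
      Fintype.sum_equiv (offEquiv c) _ _ fun x => by rw [hloop, offHol, Equiv.symm_apply_apply]
    rw [← hre, hsplit]
    exact hρ c
  obtain ⟨X, hXsu, hXn, hexact⟩ := exists_exact_lift_of_consistent hj U V hη' hρ'' hρ'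
  classical
  -- the corrected field: the prescribed values at the central crossing bonds (well defined, `β` injective), `U` elsewhere
  set g : PBond P (j+1) → Matrix.specialUnitaryGroup (Fin 2) ℂ := fun c =>
    (pre U c)⁻¹ * ((⟨exp (-X c), (specialUnitaryLogChart (Fin 2)).exp_mem (Submodule.neg_mem _ (hXsu c))⟩ :
      Matrix.specialUnitaryGroup (Fin 2) ℂ) * V c) * (post U c)⁻¹ with hg_def
  set U' : GaugeField P j (Matrix.specialUnitaryGroup (Fin 2) ℂ) :=
    fun b => if h : ∃ c, centralBond c = b then g h.choose else U b with hU'_def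
  have hg : ∀ c, U' (centralBond c) = g c := fun c => by
    have h : ∃ c', centralBond c' = centralBond (P := P) (j := j) c := ⟨c, rfl⟩
    show (if h : ∃ c', centralBond c' = centralBond c then g h.choose else U (centralBond c)) = g c
    rw [dif_pos h, centralBond_injective hj h.choose_spec]
  have hU' : ∀ b : PBond P j, (∀ c, centralBond c ≠ b) → U' b = U b := fun b hb => by
    show (if h : ∃ c', centralBond c' = b then g h.choose else U b) = U b
    rw [dif_neg (not_exists.mpr hb)]
  refine ⟨U', hU', fun c => ?_, hexact U' hg hU'⟩
  -- the displacement of the central crossing bond: `pre⁻¹ (e^{−X} − 1) pre · U(β)`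
  have hXsmall : ‖X c‖ ≤ 1 / 20 := by
    refine (hXn c).trans ?_
    calc 2 * (N : ℝ) * ρ ≤ 2 * N * (1 / (40 * N)) := by gcongr
      _ = 1 / 20 := by field_simp; ring
  have hV : V c = pre U c * U (centralBond c) * post U c := by rw [← haxial, axialAvg_eq_pre_mul_mul_post]
  set E : Matrix.specialUnitaryGroup (Fin 2) ℂ :=
    ⟨exp (-X c), (specialUnitaryLogChart (Fin 2)).exp_mem (Submodule.neg_mem _ (hXsu c))⟩ with hE
  have hgrp : g c = (pre U c)⁻¹ * E * (pre U c) * U (centralBond c) := by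
    show (pre U c)⁻¹ * (E * V c) * (post U c)⁻¹ = _
    rw [hV]; group
  rw [hg, hgrp]
  have hdiff : (((pre U c)⁻¹ * E * pre U c * U (centralBond c) : Matrix.specialUnitaryGroup (Fin 2) ℂ) : Matrix (Fin 2) (Fin 2) ℂ) -
      ((U (centralBond c) : Matrix.specialUnitaryGroup (Fin 2) ℂ) : Matrix (Fin 2) (Fin 2) ℂ) =
      (((pre U c)⁻¹ : Matrix.specialUnitaryGroup (Fin 2) ℂ) : Matrix (Fin 2) (Fin 2) ℂ) * (exp (-X c) - 1) *
        ((pre U c * U (centralBond c) : Matrix.specialUnitaryGroup (Fin 2) ℂ) : Matrix (Fin 2) (Fin 2) ℂ) := by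
    have hpp : (((pre U c)⁻¹ : Matrix.specialUnitaryGroup (Fin 2) ℂ) : Matrix (Fin 2) (Fin 2) ℂ) *
        ((pre U c : Matrix.specialUnitaryGroup (Fin 2) ℂ) : Matrix (Fin 2) (Fin 2) ℂ) = 1 := by
      rw [← Submonoid.coe_mul, inv_mul_cancel]; rfl
    simp only [Submonoid.coe_mul, hE]
    rw [mul_sub, sub_mul, mul_one]
    congr 1
    · simp only [mul_assoc]
    · rw [← mul_assoc, hpp, one_mul]
  rw [hdiff]
  refine (norm_conj_le _ _ _).trans ?_
  calc ‖exp (-X c) - 1‖ ≤ Real.exp ‖-X c‖ - 1 := Literature.Analysis.Calculus.norm_exp_sub_one_le _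
    _ ≤ 2 * ‖X c‖ := by rw [norm_neg]; exact exp_sub_one_le_two_mul (norm_nonneg _) (by linarith)
    _ ≤ 2 * (2 * N * ρ) := by gcongr; exact hXn c
    _ = 4 * N * ρ := by ring

end SU2

end Summit.QuantumFields.YangMills.Theorems.SmoothLiftCorrection

end
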